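import Literature.NumberTheory.GaloisRepresentations.HilbertNinetySubgroup
import Literature.NumberTheory.GaloisRepresentations.ArtinRestriction
import Literature.NumberTheory.EllipticCurves.TwoTorsion
import Literature.NumberTheory.EllipticCurves.Sha
import HarnessLib

/-!
# Route `ByReductionTypeAtTwo`, item `OrdKatoHalfAtTwo` (stmt-BirchSwinnertonDyer-19271), TOWER road, the
# GOOD-ORDINARY local constant at `v ∣ 2`: KERNEL BRICK ε2 — Kummer generators of continuous quadratic characters of
# an open subgroup of `Γ_K` (Hilbert 90), and the square root of `Δ` attached to a pair of `2`-torsion abscissae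

HONEST FRAMING (cell `bsd-2adic`, run/shared/lean/pub/bsd-2adic/, seat `bsd-2adic-tower-1` GEN 18, HUMAN RULINGS
D-0036 / D-0054 / D-0074; wake item «IMC-LKε kernelisation», planner RC-201, HOME/plan/WAKE-IDLE-2ADIC-IMC-LKeps-kernelisation.md):
TOOL theorems only (no definition, no named fact, no `sorry`); closes nothing by itself; nothing booked; BSD is not proved by
any of this. Second brick of the ε-REFINEMENT of the GEN 11 kernel theorem `GoodOrdTower.pTorsion_localTowerKer_at_two_le_four_kernel`
to `≤ 2` under `Δ_min ≡ ±3 (mod 8)` (IMC-LKε⁻≤, `F1Sign2.LocalKernelOneBitOffNormAtTwoLe`; MEMO-imc §10.45). The two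
«`H¹(·, ℤ/2)` = square classes» inputs of the ε-step, in the CFT-light form of the NS2 bricks (no Brauer group, no
Hilbert symbol):

* **`exists_smul_eq_ite_neg_of_contHom`** — KUMMER GENERATOR: for an OPEN subgroup `H ≤ Γ_K = Gal(K̄/K)` (`char K = 0`)
  and a continuous homomorphism `a : H → ℤ/2` there is `β ∈ K̄ˣ` with `τ β = (−1)^{a(τ)} β` for all `τ ∈ H`. Proof: with
  `F = K̄^H` (`Gal(K̄/F) = H`, Krull), `τ ↦ (−1)^{a(τ)}` is a locally constant `1`-cocycle of `Aut_F(K̄)` with values in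
  `K̄ˣ`, hence `τ ↦ τβ/β` by the tree's Hilbert 90 `AlgEquiv.exists_smul_div_eq_of_isOpen` (Serre, *Local Fields* X §1
  Prop. 2), transported along `galFixingOfAlgEquiv F : Aut_F(K̄) ↠ Gal(K̄/F)`.
* **`fourCubic_eq_zero_of_two_nsmul_eq_zero`** — the abscissa of an affine point `Q` with `2Q = O` is a root of the
  `2`-division cubic `4x³ + b₂x² + 2b₄x + b₆` (the tree's `isRoot_Ψ₂Sq_of_two_nsmul_eq_zero`).
* **`sixteen_mul_Δ_eq_sq_mul_quadDisc`** — for a root `r` of that cubic: `4x³ + b₂x² + 2b₄x + b₆ = 4(x − r)(x² + px + q)`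
  with `p = b₂/4 + r`, `q = b₄/2 + pr`, and `16Δ = (16(r² + pr + q))² (p² − 4q)` (Mathlib `twoTorsionPolynomial_discr`) —
  the ALGEBRA of «`η_E = χ_Δ`» kernel-checked by cell `bsd-f1-sign2` (seat `-imc` g5, `MEMO-imc-data/SketchG5-G3.lean`
  e80b5f7e4d39449f), re-proved here verbatim so that it lives in the tree;
* **`sq_eq_Δ_of_two_torsion_abscissae`** — for TWO DISTINCT roots `r ≠ x₀` of the cubic over a field with `2 ≠ 0` and
  `Δ ≠ 0`: `u := 16(r² + pr + q) ≠ 0` and `(u (2x₀ + p) / 4)² = Δ`. So the square root of `Δ` is a POLYNOMIAL in the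
  abscissae of two `2`-torsion points — Galois moves it exactly as it moves the second point when the first is rational
  (at a good ordinary `2`: the formal point `P₁` is `ℚ₂`-rational, the other two are defined over `ℚ₂(√Δ)`).
* `localPoints.exists_smul_some_eq`, `localPoints.some_eq_of_X_eq_of_two_nsmul_eq_zero` — bookkeeping on `E(K̄_v)`: the
  Galois action is coordinatewise, and a `2`-torsion affine point is determined by its abscissa.

References: J.-P. Serre, *Local Fields* (1979), X §1 Prop. 2; J. Silverman, *AEC* (2009), III.1, III.2.3, VIII §1;
cell memo pub/bsd-f1-sign2/MEMO-imc.md §10.44–§10.46; scope memo pub/bsd-f1-sign2/MEMO-imc-data/SCOPE-IMC-LKeps-kernel-g5.md (G2–G3).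
-/

set_option autoImplicit false
-- the Theorems namespace of this sub repeats the summit name by design (D-0017 nested layout: Summit.<S>.<Sub>)
set_option linter.dupNamespace false

noncomputable section

open scoped Classical

universe u

namespace Summit.BirchSwinnertonDyer.BirchSwinnertonDyer.Theorems.GoodOrdTower

open Field IntermediateField Literature.NumberTheory.GaloisRepresentations LocalWeilDatum WeierstrassCurve

/-! ### Kummer generators of continuous quadratic characters of an open subgroup (Hilbert 90) -/

/-- **Kummer generator of a continuous quadratic character.** Let `K` be a field of characteristic `0`, `H ≤ Γ_K` an OPEN
subgroup of the absolute Galois group and `a : H → ℤ/2` a continuous homomorphism. Then there is `β ∈ K̄`, `β ≠ 0`, with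
`τ • β = β` if `a τ = 0` and `τ • β = −β` if `a τ = 1`, for every `τ ∈ H` (so `β² ∈ K̄^H` and `K̄^{ker a} = K̄^H(β)`).
Proof: `F := K̄^H` has `Gal(K̄/F) = H` (Krull correspondence for open subgroups, `fixingSubgroup_fixedField_of_isOpen`);
`τ ↦ (−1)^{a(τ)} ∈ K̄ˣ` is a `1`-cocycle of `Aut_F(K̄)` (trivial action on `±1`) which is `1` on the open set `{a = 0}`,
so it is `τ ↦ τ(x)/x` by Hilbert's Theorem 90 in Serre's locally-constant form (`AlgEquiv.exists_smul_div_eq_of_isOpen`),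
read back on `H` through the continuous surjection `galFixingOfAlgEquiv F : Aut_F(K̄) → Gal(K̄/F)`.
[cite: SerreLocalFields1979, X §1 Prop. 2] [cite: SerreGaloisCohomology1997, II §1.2 Prop. 1] -/
theorem exists_smul_eq_ite_neg_of_contHom (K : Type u) [Field K] [CharZero K]
    (H : Subgroup (absoluteGaloisGroup K)) (hH : IsOpen (H : Set (absoluteGaloisGroup K)))
    (a : H → ZMod 2) (ha : Continuous a) (hadd : ∀ σ τ : H, a (σ * τ) = a σ + a τ) :
    ∃ β : AlgebraicClosure K, β ≠ 0 ∧
      ∀ τ : H, (τ : absoluteGaloisGroup K) • β = if a τ = 0 then β else -β := by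
  classical
  -- the fixed field `F = K̄^H`, `Gal(K̄/F) = H`
  let F : IntermediateField K (AlgebraicClosure K) := IntermediateField.fixedField H
  have hfix : F.fixingSubgroup = H := fixingSubgroup_fixedField_of_isOpen H hH
  haveI : Normal F (AlgebraicClosure K) := normal_algebraicClosure_intermediateField F
  have hHiff : ∀ σ : absoluteGaloisGroup K, σ ∈ F.fixingSubgroup ↔ σ ∈ H := fun σ ↦ SetLike.ext_iff.mp hfix σ
  have hmemH : ∀ σ : absoluteGaloisGroup K, σ ∈ galFixing K F → σ ∈ H := fun σ hσ ↦
    (hHiff σ).mp ((IntermediateField.mem_fixingSubgroup_iff F σ).mpr fun x hx ↦ (mem_galFixing_iff (F := K)).mp hσ x hx)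
  have hmemG : ∀ σ : absoluteGaloisGroup K, σ ∈ H → σ ∈ galFixing K F := fun σ hσ ↦ by
    rw [mem_galFixing_iff]
    intro x hx
    exact (IntermediateField.mem_fixedField_iff H x).mp hx σ hσ
  -- `ι : Aut_F(K̄) → H`, continuous and multiplicative
  let ι : (AlgebraicClosure K ≃ₐ[F] AlgebraicClosure K) → H := fun τ ↦
    ⟨((galFixingOfAlgEquiv F τ : galFixing K F) : absoluteGaloisGroup K), hmemH _ (galFixingOfAlgEquiv F τ).2⟩
  have hι_cont : Continuous ι :=
    (continuous_subtype_val.comp (continuous_galFixingOfAlgEquiv F)).subtype_mk _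
  have hι_mul : ∀ g h, ι (g * h) = ι g * ι h := fun g h ↦
    Subtype.ext (by
      change ((galFixingOfAlgEquiv F (g * h) : galFixing K F) : absoluteGaloisGroup K) =
        ((galFixingOfAlgEquiv F g : galFixing K F) : absoluteGaloisGroup K) *
          ((galFixingOfAlgEquiv F h : galFixing K F) : absoluteGaloisGroup K)
      rw [map_mul, Subgroup.coe_mul])
  -- values `a ∘ ι` are `0` or `1`
  have hZ : ∀ z : ZMod 2, z = 0 ∨ z = 1 := fun z ↦ by
    fin_cases z
    · exact Or.inl rfl
    · exact Or.inr rfl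
  -- the sign cocycle `f τ = (−1)^{a(ι τ)}`
  let f : (AlgebraicClosure K ≃ₐ[F] AlgebraicClosure K) → (AlgebraicClosure K)ˣ := fun g ↦
    if a (ι g) = 0 then 1 else -1
  have hf_apply : ∀ g, f g = if a (ι g) = 0 then 1 else -1 := fun _ ↦ rfl
  have hsm1 : ∀ g : AlgebraicClosure K ≃ₐ[F] AlgebraicClosure K, g • (1 : (AlgebraicClosure K)ˣ) = 1 :=
    fun g ↦ smul_one g
  have hsmn : ∀ g : AlgebraicClosure K ≃ₐ[F] AlgebraicClosure K, g • (-1 : (AlgebraicClosure K)ˣ) = -1 :=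
    fun g ↦ Units.ext (by
      rw [AlgEquiv.smul_units_def, Units.coe_map, MonoidHom.coe_coe, Units.val_neg, Units.val_one, map_neg, map_one])
  have hneg1 : (-1 : (AlgebraicClosure K)ˣ) ≠ 1 := by
    intro h
    have h' : ((-1 : (AlgebraicClosure K)ˣ) : AlgebraicClosure K) = ((1 : (AlgebraicClosure K)ˣ) : AlgebraicClosure K) :=
      congrArg Units.val h
    rw [Units.val_neg, Units.val_one] at h'
    have h2 : (2 : AlgebraicClosure K) = 0 := by linear_combination -h'
    exact two_ne_zero h2
  have hone : (1 : ZMod 2) ≠ 0 := by decide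
  have hf0 : ∀ g, a (ι g) = 0 → f g = 1 := fun g hg ↦ by rw [hf_apply, if_pos hg]
  have hf1 : ∀ g, a (ι g) = 1 → f g = -1 := fun g hg ↦ by rw [hf_apply, hg, if_neg hone]
  have hf : ∀ g h, f (g * h) = g • f h * f g := by
    intro g h
    have hgh : a (ι (g * h)) = a (ι g) + a (ι h) := by rw [hι_mul, hadd]
    rcases hZ (a (ι g)) with hg0 | hg1 <;> rcases hZ (a (ι h)) with hh0 | hh1
    · rw [hf0 _ (by rw [hgh, hg0, hh0, add_zero]), hf0 _ hh0, hf0 _ hg0, hsm1, mul_one]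
    · rw [hf1 _ (by rw [hgh, hg0, hh1, zero_add]), hf1 _ hh1, hf0 _ hg0, hsmn, mul_one]
    · rw [hf1 _ (by rw [hgh, hg1, hh0, add_zero]), hf0 _ hh0, hf1 _ hg1, hsm1, one_mul]
    · rw [hf0 _ (by rw [hgh, hg1, hh1]; rfl), hf1 _ hh1, hf1 _ hg1, hsmn, neg_mul_neg, one_mul]
  have hopen : IsOpen {g | f g = 1} := by
    have hset : {g | f g = 1} = (a ∘ ι) ⁻¹' {0} := by
      ext g
      simp only [Set.mem_setOf_eq, Set.mem_preimage, Set.mem_singleton_iff, Function.comp_apply, hf_apply]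
      constructor
      · intro hg
        by_contra hne
        rw [if_neg hne] at hg
        exact hneg1 hg
      · intro hg
        rw [if_pos hg]
    rw [hset]
    exact (isOpen_discrete _).preimage (ha.comp hι_cont)
  -- Hilbert 90
  obtain ⟨x, hx⟩ := AlgEquiv.exists_smul_div_eq_of_isOpen f hf hopen
  refine ⟨(x : AlgebraicClosure K), x.ne_zero, fun τ ↦ ?_⟩
  obtain ⟨τ', hτ'⟩ := galFixingOfAlgEquiv_surjective F ⟨(τ : absoluteGaloisGroup K), hmemG _ τ.2⟩
  have hιτ : ι τ' = τ := Subtype.ext (by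
    change ((galFixingOfAlgEquiv F τ' : galFixing K F) : absoluteGaloisGroup K) = (τ : absoluteGaloisGroup K)
    rw [hτ'])
  have hsm : (τ : absoluteGaloisGroup K) • (x : AlgebraicClosure K) = τ' (x : AlgebraicClosure K) := by
    rw [← coe_galFixingOfAlgEquiv_smul F τ' (x : AlgebraicClosure K), hτ']
  have hval : τ' (x : AlgebraicClosure K) = (f τ' : AlgebraicClosure K) * (x : AlgebraicClosure K) := by
    have h1 := congrArg (fun w : (AlgebraicClosure K)ˣ ↦ (w : AlgebraicClosure K)) (hx τ')
    simp only [Units.val_div_eq_div_val, AlgEquiv.smul_units_def, Units.coe_map, MonoidHom.coe_coe] at h1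
    rw [div_eq_iff x.ne_zero] at h1
    exact h1
  rw [hsm, hval, hf_apply, hιτ]
  split_ifs with h0
  · rw [Units.val_one, one_mul]
  · rw [Units.val_neg, Units.val_one, neg_one_mul]

/-! ### The square root of `Δ` attached to two `2`-torsion abscissae -/

section TwoTorsion

variable {F : Type u} [Field F]

/-- **The abscissa of an affine `2`-torsion point is a root of the `2`-division cubic** `4x³ + b₂x² + 2b₄x + b₆`
(the tree's `isRoot_Ψ₂Sq_of_two_nsmul_eq_zero` with Mathlib's `Ψ₂Sq = (twoTorsionPolynomial).toPoly` unfolded).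
[cite: SilvermanAEC2009, III.2.3 and Ex. 3.7] -/
theorem fourCubic_eq_zero_of_two_nsmul_eq_zero (V : WeierstrassCurve F) {x y : F}
    (h : V.toAffine.Nonsingular x y) (h2 : (2 : ℕ) • Affine.Point.some x y h = 0) :
    4 * x ^ 3 + V.b₂ * x ^ 2 + 2 * V.b₄ * x + V.b₆ = 0 := by
  have hroot := V.isRoot_Ψ₂Sq_of_two_nsmul_eq_zero h h2
  rw [Polynomial.IsRoot.def, Ψ₂Sq_eq] at hroot
  simp only [Cubic.toPoly, twoTorsionPolynomial, Polynomial.eval_add, Polynomial.eval_mul, Polynomial.eval_C,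
    Polynomial.eval_pow, Polynomial.eval_X] at hroot
  linear_combination hroot

/-- **G3 (square class of `Δ` from a `2`-torsion abscissa).** If `r` is a root of the `2`-division cubic of `V` over a
field with `2 ≠ 0`, then with `p = b₂/4 + r`, `q = b₄/2 + p r`: `4x³ + b₂x² + 2b₄x + b₆ = 4(x − r)(x² + px + q)`
identically and `16·Δ = (16(r² + pr + q))²·(p² − 4q)` (Mathlib `twoTorsionPolynomial_discr`). The algebra of
«`η_E = χ_Δ`», kernel-checked by cell `bsd-f1-sign2` (`MEMO-imc-data/SketchG5-G3.lean`) and repeated here verbatim.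
[cite: SilvermanAEC2009, III.1] -/
theorem sixteen_mul_Δ_eq_sq_mul_quadDisc (V : WeierstrassCurve F) (h2 : (2 : F) ≠ 0) (r : F)
    (hr : 4 * r ^ 3 + V.b₂ * r ^ 2 + 2 * V.b₄ * r + V.b₆ = 0) :
    (∀ x : F, 4 * x ^ 3 + V.b₂ * x ^ 2 + 2 * V.b₄ * x + V.b₆ =
        4 * (x - r) * (x ^ 2 + (V.b₂ / 4 + r) * x + (V.b₄ / 2 + (V.b₂ / 4 + r) * r))) ∧
      16 * V.Δ = (16 * (r ^ 2 + (V.b₂ / 4 + r) * r + (V.b₄ / 2 + (V.b₂ / 4 + r) * r))) ^ 2 *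
        ((V.b₂ / 4 + r) ^ 2 - 4 * (V.b₄ / 2 + (V.b₂ / 4 + r) * r)) := by
  have h4 : (4 : F) ≠ 0 := by
    have : (4 : F) = 2 * 2 := by norm_num
    rw [this]; exact mul_ne_zero h2 h2
  have hb6 : V.b₆ = -(4 * r ^ 3 + V.b₂ * r ^ 2 + 2 * V.b₄ * r) := by linear_combination hr
  refine ⟨fun x ↦ ?_, ?_⟩
  · rw [hb6]; field_simp; ring
  · rw [← V.twoTorsionPolynomial_discr]
    simp only [WeierstrassCurve.twoTorsionPolynomial, Cubic.discr]
    rw [hb6]; field_simp; ring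

/-- **The square root of `Δ` from TWO DISTINCT `2`-torsion abscissae.** Over a field with `2 ≠ 0`, let `r ≠ x₀` be two
roots of the `2`-division cubic of an elliptic curve `V` (`Δ ≠ 0`), `p = b₂/4 + r`, `q = b₄/2 + pr`, `u = 16(r² + pr + q)`.
Then `u ≠ 0` and `(u (2x₀ + p) / 4)² = Δ`: indeed `x₀² + p x₀ + q = 0` (the factorisation at `r`, `x₀ ≠ r`), so
`p² − 4q = (2x₀ + p)²` and `16Δ = u²(2x₀ + p)²`. [cite: SilvermanAEC2009, III.1] -/
theorem sq_eq_Δ_of_two_torsion_abscissae (V : WeierstrassCurve F) [V.IsElliptic] (h2 : (2 : F) ≠ 0) {r x₀ : F}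
    (hr : 4 * r ^ 3 + V.b₂ * r ^ 2 + 2 * V.b₄ * r + V.b₆ = 0)
    (hx₀ : 4 * x₀ ^ 3 + V.b₂ * x₀ ^ 2 + 2 * V.b₄ * x₀ + V.b₆ = 0) (hne : x₀ ≠ r) :
    16 * (r ^ 2 + (V.b₂ / 4 + r) * r + (V.b₄ / 2 + (V.b₂ / 4 + r) * r)) ≠ 0 ∧
      (16 * (r ^ 2 + (V.b₂ / 4 + r) * r + (V.b₄ / 2 + (V.b₂ / 4 + r) * r)) * (2 * x₀ + (V.b₂ / 4 + r)) / 4) ^ 2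
        = V.Δ := by
  obtain ⟨hfac, hΔ⟩ := sixteen_mul_Δ_eq_sq_mul_quadDisc V h2 r hr
  set u := 16 * (r ^ 2 + (V.b₂ / 4 + r) * r + (V.b₄ / 2 + (V.b₂ / 4 + r) * r)) with hu_def
  set pp := V.b₂ / 4 + r with hpp_def
  set q := V.b₄ / 2 + (V.b₂ / 4 + r) * r with hq_def
  have h4 : (4 : F) ≠ 0 := by
    have : (4 : F) = 2 * 2 := by norm_num
    rw [this]; exact mul_ne_zero h2 h2
  have hΔ0 : V.Δ ≠ 0 := V.isUnit_Δ.ne_zero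
  -- `x₀² + p x₀ + q = 0`
  have hq0 : x₀ ^ 2 + pp * x₀ + q = 0 := by
    have h0 := hfac x₀
    rw [hx₀] at h0
    have hprod : 4 * (x₀ - r) * (x₀ ^ 2 + pp * x₀ + q) = 0 := h0.symm
    rcases mul_eq_zero.mp hprod with h1 | h1
    · rcases mul_eq_zero.mp h1 with h3 | h3
      · exact absurd h3 h4
      · exact absurd (sub_eq_zero.mp h3) hne
    · exact h1
  -- `p² − 4q = (2x₀ + p)²`
  have hD : pp ^ 2 - 4 * q = (2 * x₀ + pp) ^ 2 := by linear_combination (-4 : F) * hq0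
  rw [hD] at hΔ
  have hu : u ≠ 0 := by
    intro hu0
    rw [hu0] at hΔ
    have : (16 : F) * V.Δ = 0 := by rw [hΔ]; ring
    rcases mul_eq_zero.mp this with h16 | hΔ'
    · have h16' : (16 : F) = 2 * 2 * (2 * 2) := by norm_num
      rw [h16'] at h16
      exact mul_ne_zero (mul_ne_zero h2 h2) (mul_ne_zero h2 h2) h16
    · exact hΔ0 hΔ'
  refine ⟨hu, ?_⟩
  have h16 : (16 : F) ≠ 0 := by
    have : (16 : F) = 4 * 4 := by norm_num
    rw [this]; exact mul_ne_zero h4 h4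
  have hsq : (u * (2 * x₀ + pp) / 4) ^ 2 = u ^ 2 * (2 * x₀ + pp) ^ 2 / 16 := by
    rw [div_pow, mul_pow]; norm_num
  rw [hsq, ← hΔ]
  exact mul_div_cancel_left₀ V.Δ h16

end TwoTorsion

/-! ### Bookkeeping on `E(K̄_v)`: coordinatewise action, `2`-torsion points are determined by their abscissa -/

section LocalPoints

open Literature.NumberTheory.EllipticCurves

variable {k : Type u} [Field k] (W : WeierstrassCurve k) (K : Type u) [Field K] [Algebra k K]

/-- The Galois action on `E(K̄_v)` is coordinatewise: `σ • (x, y) = (σ x, σ y)`. [cite: SilvermanAEC2009, VIII §1] -/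
theorem localPoints.exists_smul_some_eq (σ : absoluteGaloisGroup K) {x y : AlgebraicClosure K}
    (h : (W.baseChange (AlgebraicClosure K)).toAffine.Nonsingular x y) :
    ∃ h', σ • (show localPoints W K from Affine.Point.some x y h) = Affine.Point.some (σ • x) (σ • y) h' :=
  ⟨_, by rw [localPoints.smul_def, Affine.Point.map_some]; rfl⟩

/-- An affine point with `2Q = O` is determined by its abscissa among affine points: if `Q = (x₀, y₀)`, `2Q = O`
and `Q' = (x₀, y')` then `Q' = Q` (as `Q' = ±Q` and `−Q = Q`). [cite: SilvermanAEC2009, III.2.3] -/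
theorem localPoints.some_eq_of_X_eq_of_two_nsmul_eq_zero {x₀ y₀ x' y' : AlgebraicClosure K}
    {h₀ : (W.baseChange (AlgebraicClosure K)).toAffine.Nonsingular x₀ y₀}
    {h' : (W.baseChange (AlgebraicClosure K)).toAffine.Nonsingular x' y'}
    (h2 : (2 : ℕ) • (show localPoints W K from Affine.Point.some x₀ y₀ h₀) = 0) (hx : x' = x₀) :
    (show localPoints W K from Affine.Point.some x' y' h') = Affine.Point.some x₀ y₀ h₀ := by
  have hneg : -(show localPoints W K from Affine.Point.some x₀ y₀ h₀) = Affine.Point.some x₀ y₀ h₀ := by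
    rw [two_nsmul, add_eq_zero_iff_neg_eq] at h2
    exact h2
  rcases (Affine.Point.X_eq_iff (h₁ := h') (h₂ := h₀)).mp hx with h | h
  · exact h
  · exact h.trans hneg

end LocalPoints

end Summit.BirchSwinnertonDyer.BirchSwinnertonDyer.Theorems.GoodOrdTower

end
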